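import Literature.MathematicalPhysics.QuantumLattice.ShiftedHubbardDysonDeterminant
import Literature.MathematicalPhysics.QuantumLattice.DWaveSourceParticleHole

/-!
# The renormalised determinant expansion of a pair-sourced interacting Fermi gas around its BdG propagator

For "BdG + on-site interaction" Hamiltonians `H_BdG(τ,Δ,μ) + U Σ_x (n_{x↑} − ν₀)(n_{x↓} − ν₁)` (any
finite vertex set, any bond pairing `Δ`, complex Hartree shifts `ν₀, ν₁`) Lieb's partial particle–hole
transformation `W` (spin-down orbitals exchanged) gives a NUMBER-CONSERVING model: the pairing becomes a
spin-flip hopping inside the Nambu one-body matrix `𝓝 = bdgNambuMatrix τ Δ μ`, and the shifted on-site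
vertex stays a shifted on-site vertex with the opposite sign of the coupling and the complementary
down-shift: `W (n↑ − ν₀)(n↓ − ν₁) Wᴴ = −(n↑ − ν₀)(n↓ − (1 − ν₁))`. Hence the partition function is an
entire series in `U` whose coefficients are free (BdG) expectations of shifted density words, i.e. —
by the shifted Wick theorem (`ShiftedWickDeterminant`, `ShiftedHubbardDysonDeterminant`) — determinants
of the Nambu propagator matrix with the shifts subtracted on the diagonal:

* `partialParticleHole_conj_sum_shiftedOnSite` — `W Σ_x(n_{x↑} − a)(n_{x↓} − b) Wᴴ = −Σ_x(n_{x↑} − a)(n_{x↓} − (1−b))`;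
* `partialParticleHole_conj_bdgBondHamiltonian_add_shiftedOnSite` — the transformed Hamiltonian
  `dΓ(𝓝) + (−U) Σ_x (n_{x↑} − ν₀)(n_{x↓} − ν₁) + (Σ_x (τ_{xx} − μ))·1` (shifts `ν₀, 1 − ν₁` on the
  physical side);
* `hasSum_partitionFn_bdgBondHamiltonian_add_shiftedOnSite_det` —
  `Tr e^{−β(H_BdG + UΣ(n↑−ν₀)(n↓−(1−ν₁)))} = e^{−βΣ(τxx−μ)} Σ_k (−U)^k (−β)^k ∫ Σ_{x⃗} Z₀(𝓝) det(G_k(𝓝) − D_ν) du`;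
* `bdgBondHamiltonian_add_onSite_eq_shifted` — the unshifted model at chemical potential `μ` is the
  shifted one at `μ − Uν` up to the constant `−Uν²|Λ|` (`U n↑n↓ = U(n↑−ν)(n↓−ν) + Uν(n↑+n↓) − Uν²`);
* `hasSum_partitionFn_dWaveSourceTorus_shifted_det` — for the `d`-wave–sourced repulsive Hubbard
  torus `dWaveSourceTorus L U μ h`: for EVERY real Hartree shift `ν`, its partition function is
  `e^{β(μ − Uν + Uν²)L²}` times the entire series in `U` with coefficients
  `Z₀ det (G_k(𝓝_{μ−Uν,h}) − D)`, `D = diagonal (2i+j ↦ (ν, 1−ν)_j)` — the starting point of a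
  RENORMALISED (tadpole-subtracted) expansion of the sourced pressure around the BdG propagator.

## References
* E. H. Lieb, Phys. Rev. Lett. 62 (1989) 1201 (the partial particle–hole transformation).
  [cite: Lieb1989, proof of Theorem 2]
* G. Benfatto, A. Giuliani, V. Mastropietro, Ann. Henri Poincaré 7 (2006) 809, §2 (determinant
  expansion with counterterm). [cite: BenfattoGiulianiMastropietro2006, §2]
-/

noncomputable section

namespace Literature.MathematicalPhysics.QuantumLattice

open NormedSpace Matrix Finset
open scoped ComplexOrder

section General

variable {Λ : Type*} [LinearOrder Λ] [Fintype Λ]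

/-- **The shifted on-site vertex under Lieb's transformation**: for complex `a, b`,
`W (Σ_x (n_{x↑} − a·1)(n_{x↓} − b·1)) Wᴴ = −Σ_x (n_{x↑} − a·1)(n_{x↓} − (1 − b)·1)`
(`W n_{x↑} Wᴴ = n_{x↑}`, `W n_{x↓} Wᴴ = 1 − n_{x↓}`). [cite: Lieb1989, proof of Theorem 2] -/
theorem partialParticleHole_conj_sum_shiftedOnSite (a b : ℂ) :
    partialParticleHole (spinDownOrbitals : Finset (Orb Λ)) *
        (∑ x : Λ, (numberOp x 0 - a • (1 : Matrix (Finset (Orb Λ)) (Finset (Orb Λ)) ℂ)) *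
          (numberOp x 1 - b • (1 : Matrix (Finset (Orb Λ)) (Finset (Orb Λ)) ℂ))) *
        (partialParticleHole (spinDownOrbitals : Finset (Orb Λ)))ᴴ =
      -∑ x : Λ, (numberOp x 0 - a • (1 : Matrix (Finset (Orb Λ)) (Finset (Orb Λ)) ℂ)) *
        (numberOp x 1 - (1 - b) • (1 : Matrix (Finset (Orb Λ)) (Finset (Orb Λ)) ℂ)) := by
  set W := partialParticleHole (spinDownOrbitals : Finset (Orb Λ)) with hW
  have hWW : W * Wᴴ = 1 := partialParticleHole_mul_conjTranspose _
  have hsub : ∀ (A : Matrix (Finset (Orb Λ)) (Finset (Orb Λ)) ℂ) (c : ℂ),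
      W * (A - c • 1) * Wᴴ = W * A * Wᴴ - c • 1 := by
    intro A c
    rw [Matrix.mul_sub, Matrix.sub_mul, Matrix.mul_smul, Matrix.mul_one, Matrix.smul_mul, hWW]
  rw [partialParticleHole_conj_sum, ← Finset.sum_neg_distrib]
  refine Finset.sum_congr rfl fun x _ => ?_
  rw [partialParticleHole_conj_mul, hsub, hsub, hW, partialParticleHole_conj_numberOp_up,
    partialParticleHole_conj_numberOp_down, sub_smul, one_smul]
  simp only [mul_sub, Matrix.mul_one]
  abel

/-- **Lieb's transformation of "BdG + shifted on-site interaction"**: with `𝓝 = bdgNambuMatrix τ Δ μ`,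
`W (H_BdG(τ,Δ,μ) + U Σ_x (n_{x↑} − ν₀)(n_{x↓} − (1 − ν₁))) Wᴴ
  = dΓ(𝓝) + (−U) Σ_x (n_{x↑} − ν₀)(n_{x↓} − ν₁) + (Σ_x (τ_{xx} − μ))·1` — a number-conserving free
Fermi gas perturbed by a SHIFTED on-site quartic word with the attractive coupling `−U`.
[cite: Lieb1989, proof of Theorem 2] -/
theorem partialParticleHole_conj_bdgBondHamiltonian_add_shiftedOnSite (τ Δ : Λ → Λ → ℂ) (μ : ℝ)
    (U : ℂ) (ν : Fin 2 → ℂ) :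
    partialParticleHole (spinDownOrbitals : Finset (Orb Λ)) *
        (bdgBondHamiltonian τ Δ μ + U • ∑ x : Λ,
          (numberOp x 0 - ν 0 • (1 : Matrix (Finset (Orb Λ)) (Finset (Orb Λ)) ℂ)) *
            (numberOp x 1 - (1 - ν 1) • (1 : Matrix (Finset (Orb Λ)) (Finset (Orb Λ)) ℂ))) *
        (partialParticleHole (spinDownOrbitals : Finset (Orb Λ)))ᴴ =
      dGamma (bdgNambuMatrix τ Δ μ) +
        (-U) • (∑ x : Λ, (numberOp x 0 - ν 0 • (1 : Matrix (Finset (Orb Λ)) (Finset (Orb Λ)) ℂ)) *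
          (numberOp x 1 - ν 1 • (1 : Matrix (Finset (Orb Λ)) (Finset (Orb Λ)) ℂ))) +
        (∑ x : Λ, (τ x x - μ)) • (1 : Matrix (Finset (Orb Λ)) (Finset (Orb Λ)) ℂ) := by
  rw [Matrix.mul_add, Matrix.add_mul, partialParticleHole_conj_bdgBondHamiltonian, partialParticleHole_conj_smul,
    partialParticleHole_conj_sum_shiftedOnSite, sub_sub_cancel, smul_neg, neg_smul]
  abel

/-- **The Dyson series in `U` of "BdG + shifted on-site interaction", determinant form (finite
volume).** For Hermitian hopping data `τ`, any bond pairing `Δ`, real `μ, U, β` and complex shifts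
`ν₀, ν₁`, with `𝓝 = bdgNambuMatrix τ Δ μ`, `Z₀ = Tr e^{−βdΓ(𝓝)}`:
`Tr e^{−β(H_BdG(τ,Δ,μ) + U Σ_x (n_{x↑} − ν₀)(n_{x↓} − (1−ν₁)))}
  = e^{−βΣ_x(τ_{xx}−μ)} Σ_k (−U)^k (−β)^k ∫_{0≤u₀≤⋯≤u_{k−1}≤1} Σ_{x⃗∈Λ^k} Z₀ det (G_k(𝓝; x⃗, u) − D) du`,
`G_k` the `2k × 2k` pair-indexed Nambu propagator matrix (`propMatrix`, position `2i + j` ↔ orbital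
`(xᵢ, j)` at time `sᵢ = −βuᵢ`), `D = diagonal (2i + j ↦ ν_j)`. The pairing sits in the FREE propagator;
the interaction is the shifted on-site word; entire in `U`. [cite: BenfattoGiulianiMastropietro2006, §2.1 (2.6)] -/
theorem hasSum_partitionFn_bdgBondHamiltonian_add_shiftedOnSite_det {τ : Λ → Λ → ℂ}
    (hτ : ∀ x y, star (τ x y) = τ y x) (Δ : Λ → Λ → ℂ) (μ U β : ℝ) (ν : Fin 2 → ℂ) :
    HasSum (fun k : ℕ => Complex.exp (-(β : ℂ) * ∑ x : Λ, (τ x x - μ)) *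
      ((-(U : ℂ)) ^ k * orderedIntegral k (fun u : Fin k → ℝ =>
        (-(β : ℂ)) ^ k * ∑ f : Fin k → Λ, Matrix.partitionFn β (dGamma (bdgNambuMatrix τ Δ μ)) *
          (propMatrix β (bdgNambuMatrix τ Δ μ)
              (fun m : Fin (k * 2) => orb (f (finProdFinEquiv.symm m).1) (finProdFinEquiv.symm m).2)
              (fun m : Fin (k * 2) => orb (f (finProdFinEquiv.symm m).1) (finProdFinEquiv.symm m).2)
              (fun m : Fin (k * 2) => (((u (finProdFinEquiv.symm m).1 : ℝ) : ℂ) * -(β : ℂ))) -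
            Matrix.diagonal (fun m : Fin (k * 2) => ν (finProdFinEquiv.symm m).2)).det) 1))
      (Matrix.partitionFn β (bdgBondHamiltonian τ Δ μ + (U : ℂ) • ∑ x : Λ,
        (numberOp x 0 - ν 0 • (1 : Matrix (Finset (Orb Λ)) (Finset (Orb Λ)) ℂ)) *
          (numberOp x 1 - (1 - ν 1) • (1 : Matrix (Finset (Orb Λ)) (Finset (Orb Λ)) ℂ)))) := by
  haveI : Nonempty (Finset (Orb Λ)) := ⟨∅⟩
  have hK : (bdgNambuMatrix τ Δ μ).IsHermitian := isHermitian_bdgNambuMatrix hτ Δ μ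
  have hZ : Matrix.partitionFn β (dGamma (bdgNambuMatrix τ Δ μ)) ≠ 0 :=
    (Matrix.partitionFn_pos β (isHermitian_dGamma hK)).ne'
  -- unitary conjugation and the transformed Hamiltonian
  have hW : partialParticleHole (spinDownOrbitals : Finset (Orb Λ)) ∈
      unitary (Matrix (Finset (Orb Λ)) (Finset (Orb Λ)) ℂ) :=
    partialParticleHole_mem_unitaryGroup _
  have hZeq : Matrix.partitionFn β (bdgBondHamiltonian τ Δ μ + (U : ℂ) • ∑ x : Λ,
      (numberOp x 0 - ν 0 • (1 : Matrix (Finset (Orb Λ)) (Finset (Orb Λ)) ℂ)) *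
        (numberOp x 1 - (1 - ν 1) • (1 : Matrix (Finset (Orb Λ)) (Finset (Orb Λ)) ℂ))) =
      Complex.exp (-(β : ℂ) * ∑ x : Λ, (τ x x - μ)) *
        Matrix.partitionFn β (dGamma (bdgNambuMatrix τ Δ μ) +
          (-(U : ℂ)) • ∑ x : Λ, (numberOp x 0 - ν 0 • (1 : Matrix (Finset (Orb Λ)) (Finset (Orb Λ)) ℂ)) *
            (numberOp x 1 - ν 1 • (1 : Matrix (Finset (Orb Λ)) (Finset (Orb Λ)) ℂ))) := by
    rw [← partitionFn_unitary_conj hW β (bdgBondHamiltonian τ Δ μ + (U : ℂ) • _), star_eq_conjTranspose,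
      partialParticleHole_conj_bdgBondHamiltonian_add_shiftedOnSite, Matrix.partitionFn,
      gibbsWeight_add_smul_one, trace_smul, smul_eq_mul, Matrix.partitionFn]
  rw [hZeq]
  -- the Dyson series of the transformed model, in trace form
  have hs := hasSum_dyson_partitionFn_shiftedQuartic β (bdgNambuMatrix τ Δ μ) (fun _ : Λ => (1 : ℂ))
    (fun z => orb z 0) (fun z => orb z 0) (fun z => orb z 1) (fun z => orb z 1)
    (fun _ => ν 0) (fun _ => ν 1) (-(U : ℂ))
  simp only [Finset.prod_const_one, one_mul, one_smul] at hs
  refine (hs.mul_left _).congr_fun fun k => ?_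
  refine congrArg (fun F => Complex.exp (-(β : ℂ) * ∑ x : Λ, (τ x x - μ)) *
    ((-(U : ℂ)) ^ k * orderedIntegral k F 1)) (funext fun u => ?_)
  refine congrArg (fun S => (-(β : ℂ)) ^ k * S) (Finset.sum_congr rfl fun f _ => ?_)
  rw [← gibbsState_dGamma_prod_shiftedHubbardVertex_eq_det hK β f
    (fun i : Fin k => ((u i : ℝ) : ℂ) * -(β : ℂ)) ν, Matrix.gibbsState_apply, mul_inv_cancel_left₀ hZ]

/-- **Moving the Hartree shift into the chemical potential**: for real `μ, U, ν`,
`H_BdG(τ,Δ,μ) + U Σ_x n_{x↑}n_{x↓} = H_BdG(τ,Δ,μ − Uν) + U Σ_x (n_{x↑} − ν)(n_{x↓} − ν) − Uν²|Λ|·1`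
(`U n↑n↓ = U(n↑ − ν)(n↓ − ν) + Uν(n↑ + n↓) − Uν²`, and `−μN + UνN = −(μ − Uν)N`). [folklore] -/
theorem bdgBondHamiltonian_add_onSite_eq_shifted (τ Δ : Λ → Λ → ℂ) (μ U ν : ℝ) :
    bdgBondHamiltonian τ Δ μ + (U : ℂ) • ∑ x : Λ, numberOp x 0 * numberOp x 1 =
      bdgBondHamiltonian τ Δ (μ - U * ν) + (U : ℂ) • (∑ x : Λ,
          (numberOp x 0 - (ν : ℂ) • (1 : Matrix (Finset (Orb Λ)) (Finset (Orb Λ)) ℂ)) *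
            (numberOp x 1 - (ν : ℂ) • (1 : Matrix (Finset (Orb Λ)) (Finset (Orb Λ)) ℂ))) -
        ((U * ν ^ 2 * Fintype.card Λ : ℝ) : ℂ) • (1 : Matrix (Finset (Orb Λ)) (Finset (Orb Λ)) ℂ) := by
  have hvertex : ∀ x : Λ, (numberOp x 0 - (ν : ℂ) • (1 : Matrix (Finset (Orb Λ)) (Finset (Orb Λ)) ℂ)) *
      (numberOp x 1 - (ν : ℂ) • 1) =
        numberOp x 0 * numberOp x 1 - (ν : ℂ) • (numberOp x 0 + numberOp x 1) +
          ((ν : ℂ) * ν) • (1 : Matrix (Finset (Orb Λ)) (Finset (Orb Λ)) ℂ) := by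
    intro x
    simp only [sub_mul, mul_sub, Matrix.mul_smul, Matrix.mul_one, Matrix.smul_mul, Matrix.one_mul,
      smul_smul, smul_add]
    abel
  have hN : ∑ x : Λ, (numberOp x 0 + numberOp x 1) = (totalNumber : Matrix (Finset (Orb Λ)) (Finset (Orb Λ)) ℂ) := by
    rw [totalNumber]
    refine Finset.sum_congr rfl fun x _ => ?_
    rw [Fin.sum_univ_two]
  have hμ : bdgBondHamiltonian τ Δ (μ - U * ν) = bdgBondHamiltonian τ Δ μ + ((U * ν : ℝ) : ℂ) • totalNumber := by
    rw [bdgBondHamiltonian_eq, bdgBondHamiltonian_eq, Complex.ofReal_sub, sub_smul]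
    abel
  simp_rw [hvertex]
  rw [Finset.sum_add_distrib, Finset.sum_sub_distrib, Finset.sum_const, Finset.card_univ,
    ← Finset.smul_sum, hN, hμ, smul_add, smul_sub, smul_smul,
    ← Nat.cast_smul_eq_nsmul ℂ (Fintype.card Λ), smul_smul, smul_smul]
  have e1 : ((U : ℝ) : ℂ) * ((Fintype.card Λ : ℕ) : ℂ) * ((ν : ℂ) * ν) =
      ((U * ν ^ 2 * Fintype.card Λ : ℝ) : ℂ) := by
    push_cast; ring
  rw [e1]
  push_cast
  abel

/-- **Partition functions: the shifted model at `μ − Uν` versus the unshifted one at `μ`**: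
`Tr e^{−β(H_BdG(τ,Δ,μ−Uν) + UΣ_x(n_{x↑}−ν)(n_{x↓}−ν))} = e^{−βUν²|Λ|} Tr e^{−β(H_BdG(τ,Δ,μ) + UΣ_x n_{x↑}n_{x↓})}`.
[folklore] -/
theorem partitionFn_bdgBondHamiltonian_add_shiftedOnSite_eq (τ Δ : Λ → Λ → ℂ) (μ U ν β : ℝ) :
    Matrix.partitionFn β (bdgBondHamiltonian τ Δ (μ - U * ν) + (U : ℂ) • ∑ x : Λ,
        (numberOp x 0 - (ν : ℂ) • (1 : Matrix (Finset (Orb Λ)) (Finset (Orb Λ)) ℂ)) *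
          (numberOp x 1 - (ν : ℂ) • (1 : Matrix (Finset (Orb Λ)) (Finset (Orb Λ)) ℂ))) =
      (Real.exp (-(β * (U * ν ^ 2 * Fintype.card Λ))) : ℂ) *
        Matrix.partitionFn β (bdgBondHamiltonian τ Δ μ + (U : ℂ) • ∑ x : Λ, numberOp x 0 * numberOp x 1) := by
  have hH : bdgBondHamiltonian τ Δ (μ - U * ν) + (U : ℂ) • (∑ x : Λ,
      (numberOp x 0 - (ν : ℂ) • (1 : Matrix (Finset (Orb Λ)) (Finset (Orb Λ)) ℂ)) *
        (numberOp x 1 - (ν : ℂ) • (1 : Matrix (Finset (Orb Λ)) (Finset (Orb Λ)) ℂ))) =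
      (bdgBondHamiltonian τ Δ μ + (U : ℂ) • ∑ x : Λ, numberOp x 0 * numberOp x 1) +
        ((U * ν ^ 2 * Fintype.card Λ : ℝ) : ℂ) • (1 : Matrix (Finset (Orb Λ)) (Finset (Orb Λ)) ℂ) := by
    rw [bdgBondHamiltonian_add_onSite_eq_shifted τ Δ μ U ν, sub_add_cancel]
  rw [hH, Matrix.partitionFn, gibbsWeight_add_smul_one, trace_smul, smul_eq_mul, Matrix.partitionFn]
  congr 1
  rw [Complex.ofReal_exp]
  push_cast
  ring_nf

end General

/-! ### The `d`-wave–sourced repulsive Hubbard torus -/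

section Torus

variable (L : ℕ) [NeZero L]

/-- **The renormalised determinant expansion of the `d`-wave–sourced Hubbard torus partition function
around the BdG propagator, at an arbitrary Hartree shift.** For every `L ≥ 1` and all real
`β, U, μ, h, ν`, with `𝓝 = bdgNambuMatrix τ_L Δ_{L,h} (μ − Uν)` (the Nambu one-body matrix of the
transformed sourced torus at the shifted chemical potential; `τ_L = −[x∼y]`, `Δ_{L,h}` the `d`-wave bond
pairing of strength `−h√2(±1)`) and `Z₀ = Tr e^{−βdΓ(𝓝)}`:
`Tr e^{−β dWaveSourceTorus L U μ h}
  = e^{β(μ − Uν + Uν²)L²} Σ_k (−U)^k (−β)^k ∫_{0≤u₀≤⋯≤u_{k−1}≤1} Σ_{x⃗} Z₀ det (G_k(𝓝; x⃗, u) − D) du`,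
`D = diagonal (2i + j ↦ (ν, 1 − ν)_j)` — an entire series in `U` for every shift `ν`, whose coefficients
are SHIFTED determinants of the sourced free (BdG) propagator: the finite-volume identity behind a
tadpole-subtracted expansion of the sourced pressure (the shift `ν` to be fixed by the Hartree
condition). [cite: BenfattoGiulianiMastropietro2006, §2.1 (2.6)] -/
theorem hasSum_partitionFn_dWaveSourceTorus_shifted_det (β U μ h ν : ℝ) :
    HasSum (fun k : ℕ => (Real.exp (β * ((μ - U * ν + U * ν ^ 2) * (L : ℝ) ^ 2)) : ℂ) *
      ((-(U : ℂ)) ^ k * orderedIntegral k (fun u : Fin k → ℝ =>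
        (-(β : ℂ)) ^ k * ∑ f : Fin k → FermionTorus 2 L,
          Matrix.partitionFn β (dGamma (bdgNambuMatrix
            (fun x y => if (fermionTorusGraph 2 L).Adj x y then -(1 : ℂ) else 0)
            (fun u v : FermionTorus 2 L => -(h : ℂ) * ∑ i : Fin 2,
              if v = FermionTorus.ofTorusSite (u.toTorusSite + Pi.single i 1) then
                ((Real.sqrt 2 * (if i = 0 then 1 else -1) : ℝ) : ℂ) else 0) (μ - U * ν))) *
          (propMatrix β (bdgNambuMatrix
              (fun x y => if (fermionTorusGraph 2 L).Adj x y then -(1 : ℂ) else 0)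
              (fun u v : FermionTorus 2 L => -(h : ℂ) * ∑ i : Fin 2,
                if v = FermionTorus.ofTorusSite (u.toTorusSite + Pi.single i 1) then
                  ((Real.sqrt 2 * (if i = 0 then 1 else -1) : ℝ) : ℂ) else 0) (μ - U * ν))
              (fun m : Fin (k * 2) => orb (f (finProdFinEquiv.symm m).1) (finProdFinEquiv.symm m).2)
              (fun m : Fin (k * 2) => orb (f (finProdFinEquiv.symm m).1) (finProdFinEquiv.symm m).2)
              (fun m : Fin (k * 2) => (((u (finProdFinEquiv.symm m).1 : ℝ) : ℂ) * -(β : ℂ))) -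
            Matrix.diagonal (fun m : Fin (k * 2) =>
              (![(ν : ℂ), 1 - (ν : ℂ)] : Fin 2 → ℂ) (finProdFinEquiv.symm m).2)).det) 1))
      (Matrix.partitionFn β (dWaveSourceTorus L U μ h)) := by
  have hcard : (Fintype.card (FermionTorus 2 L) : ℝ) = (L : ℝ) ^ 2 := by
    simp [FermionTorus, Fintype.card_lex]
  have hcardC : (Fintype.card (FermionTorus 2 L) : ℂ) = (L : ℂ) ^ 2 := by
    simp [FermionTorus, Fintype.card_lex]
  have hdiag : (∑ x : FermionTorus 2 L,
      ((if (fermionTorusGraph 2 L).Adj x x then -(1 : ℂ) else 0) - ((μ - U * ν : ℝ) : ℂ))) =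
        -(((μ - U * ν : ℝ) : ℂ) * (L : ℂ) ^ 2) := by
    simp only [SimpleGraph.irrefl, if_false, zero_sub, Finset.sum_neg_distrib, Finset.sum_const,
      Finset.card_univ, nsmul_eq_mul, hcardC]
    ring
  have hτ : ∀ x y : FermionTorus 2 L,
      star (if (fermionTorusGraph 2 L).Adj x y then -(1 : ℂ) else 0) =
        (if (fermionTorusGraph 2 L).Adj y x then -(1 : ℂ) else 0) := by
    intro x y
    rw [apply_ite star, star_neg, star_one, star_zero]
    simp only [(fermionTorusGraph 2 L).adj_comm x y]
  -- the determinant series of the shifted model at `μ - Uν` (shifts `(ν, 1 - ν)`; `1 - (1 - ν) = ν`),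
  -- moved back to the unshifted sourced torus at `μ`
  have key := hasSum_partitionFn_bdgBondHamiltonian_add_shiftedOnSite_det (Λ := FermionTorus 2 L) hτ
    (fun u v : FermionTorus 2 L => -(h : ℂ) * ∑ i : Fin 2,
      if v = FermionTorus.ofTorusSite (u.toTorusSite + Pi.single i 1) then
        ((Real.sqrt 2 * (if i = 0 then 1 else -1) : ℝ) : ℂ) else 0) (μ - U * ν) U β
    (![(ν : ℂ), 1 - (ν : ℂ)] : Fin 2 → ℂ)
  simp only [Matrix.cons_val_zero, Matrix.cons_val_one, sub_sub_cancel] at key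
  rw [hdiag, partitionFn_bdgBondHamiltonian_add_shiftedOnSite_eq, hcard,
    ← dWaveSourceTorus_eq_bdgBondHamiltonian_add] at key
  -- remove `e^{-βUν²L²}` from the limit and collect the prefactors of the summands
  have key2 := key.mul_left ((Real.exp (β * (U * ν ^ 2 * (L : ℝ) ^ 2)) : ℂ))
  have hlim : ∀ Z : ℂ, (Real.exp (β * (U * ν ^ 2 * (L : ℝ) ^ 2)) : ℂ) *
      ((Real.exp (-(β * (U * ν ^ 2 * (L : ℝ) ^ 2))) : ℂ) * Z) = Z := by
    intro Z
    rw [← mul_assoc, ← Complex.ofReal_mul, ← Real.exp_add, add_neg_cancel, Real.exp_zero,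
      Complex.ofReal_one, one_mul]
  have hexp : ∀ X : ℂ, (Real.exp (β * (U * ν ^ 2 * (L : ℝ) ^ 2)) : ℂ) *
      (Complex.exp (-(β : ℂ) * -(((μ - U * ν : ℝ) : ℂ) * (L : ℂ) ^ 2)) * X) =
        (Real.exp (β * ((μ - U * ν + U * ν ^ 2) * (L : ℝ) ^ 2)) : ℂ) * X := by
    intro X
    rw [← mul_assoc, Complex.ofReal_exp, Complex.ofReal_exp, ← Complex.exp_add]
    congr 2
    push_cast
    ring
  rw [hlim] at key2
  simp only [hexp] at key2
  -- the generic (`LinearOrder Λ`) and the concrete (`Lex`) `DecidableEq` paths meet here, and the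
  -- `AddCommMonoid ℂ` shortcut instance meets the ring-derived one of `HasSum.mul_left`
  convert key2
  exact AddCommMonoid.ext rfl

end Torus

end Literature.MathematicalPhysics.QuantumLattice
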